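import Summits.Ventures.CertifiedArithmetic.LowPrec.GemmThetaE2M3Defs

/-!
# The θ-certificate of E2M3²→bfloat16: kernel check of the states with index in `[1280, 1344)`

HONEST FRAMING (venture CertifiedArithmetic / cell `pub-lowprec`, seat gemm, gen 7): certified error
envelopes and provably optimal rounding/accumulation schemes for low-precision formats under stated
cost models; every table by two implementations; no hardware or vendor claims.

Part 21 of 29 of the kernel check of the Boolean certificate of `GemmThetaE2M3Defs.lean`
(paper `gemm.tex` §Regimes Prop. Θ(i), configuration E2M3·E2M3 → `bfloat16`, sequential, RNE): every
edge from the states with index `1280 ≤ i < 1344` (both signs, all 443 letters, with the pair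
checks after free moves) passes `edgeOK`, by `decide +kernel` in chunks of 16 indices (each chunk
≈ 14,176 edges).  Split into files only to keep each file's kernel time near three minutes;
`GemmThetaE2M3.lean` assembles the parts.  See the Defs file for the meaning of the check.
-/

namespace Literature.ComputerArithmetic.FloatingPoint

namespace MiniFloat

namespace ThetaE2M3

/-- Every edge from the states with index in `[1280, 1296)` (both signs, all 443 letters) passes
`edgeOK`. [cell certificate, kernel-checked] -/
theorem edges_ok_1280 : rowsOK 1280 16 = true := by
  decide +kernel

/-- Every edge from the states with index in `[1296, 1312)` (both signs, all 443 letters) passes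
`edgeOK`. [cell certificate, kernel-checked] -/
theorem edges_ok_1296 : rowsOK 1296 16 = true := by
  decide +kernel

/-- Every edge from the states with index in `[1312, 1328)` (both signs, all 443 letters) passes
`edgeOK`. [cell certificate, kernel-checked] -/
theorem edges_ok_1312 : rowsOK 1312 16 = true := by
  decide +kernel

/-- Every edge from the states with index in `[1328, 1344)` (both signs, all 443 letters) passes
`edgeOK`. [cell certificate, kernel-checked] -/
theorem edges_ok_1328 : rowsOK 1328 16 = true := by
  decide +kernel

/-- PART 21: every edge from the states with index in `[1280, 1344)` passes `edgeOK`.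
[cell certificate, kernel-checked] -/
theorem part_21 : rowsOK 1280 64 = true :=
  rowsOK_append (l₁ := 16) (l₂ := 48) rfl edges_ok_1280 <|
  rowsOK_append (l₁ := 16) (l₂ := 32) rfl edges_ok_1296 <|
  rowsOK_append (l₁ := 16) (l₂ := 16) rfl edges_ok_1312 <|
  edges_ok_1328

end ThetaE2M3

end MiniFloat

end Literature.ComputerArithmetic.FloatingPoint
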